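import Mathlib
import Summits.QuantumFields.YangMills.Theses.FluxSectorAlternative
import Literature.MathematicalPhysics.QuantumFieldTheory.PlaquetteWeightVortexBound
import Literature.MathematicalPhysics.QuantumLattice.RepLieAlgebraUnitary

/-!
# `FluxSectorAlternative.Assembly` — proof (item stmt-QuantumFields-23872)

Pure logic: given the three items of route `FluxSectorAlternative`, the leaf
`WeakCouplingMasslessPhase.DeconfinedIsMassless` follows by choosing the species of `GapForcesFluxAlternative`,
splitting 't Hooft's alternative for every centre element and plane, discarding the heavy branch with `NoHiggsMode`,
and handing the light (area-rate) branch to `VortexAreaLawDeniesPerimeter`, which denies the perimeter hypothesis.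
-/

namespace Summit.QuantumFields.YangMills.Theorems.FluxSectorAlternative

open Summit.QuantumFields.YangMills.Theses.FluxSectorAlternative

/-- The assembly item of route `FluxSectorAlternative` holds (eight lines of logic). -/
theorem assembly_proof : Summit.QuantumFields.YangMills.Theses.FluxSectorAlternative.Assembly := by
  intro hK1 hK2 hK3 N hN r
  obtain ⟨A, B, hAB⟩ := hK1 N hN r
  refine ⟨A, B, fun β hβ hper hclus => ?_⟩
  refine hK3 N hN r β hβ ?_ hper
  intro z hz hz1 q
  rcases hAB β hβ hclus z hz hz1 q with harea | hzero
  · exact harea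
  · exact absurd hzero (hK2 N hN r β hβ z hz hz1 q)

/-! ## Second part:
# BC5 rung for the deciding crux `GapForcesFluxAlternative` (LINE g20-A `FluxSectorAlternative`, seat ym-idea-4)

The crux says: a volume-uniform zero-flux gap forces, for every non-trivial centre element `z` and plane `q`, the
't Hooft alternative «`1 - Z_z(L⁴)/Z(L⁴) ≤ C' L² e^{-σ L²}` (area-rate light magnetic flux) OR `Z_z/Z → 0` (heavy)».
FIRST RUNG (proved here from the tree): for `N = 2`, `r` = the fundamental representation, `z = -𝟙`, and every
coupling in the convergent strong-coupling disc `|β| ≤ 1/(8·25²·e²)`, the FIRST branch holds outright (so the crux's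
instance `(N, r, z) = (2, fund, -𝟙)` holds there with either value of the gap hypothesis).  Source theorem:
`Tomboulis2007.mainClaimTHooft_of_abs_le` (Osterwalder–Seiler / Münster cluster expansion for the vortex free energy,
typed in `PlaquetteWeightVortexBound`).  Why this is a witness and not the leaf: the leaf `DeconfinedIsMassless` is an
infinite-volume statement about perimeter laws of limit Gibbs states; the rung is a finite-torus partition-function
inequality — the currency the whole line works in — and it exercises exactly the input Tomboulis–Yaffe consumes
(crux `VortexAreaLawDeniesPerimeter`).  Honest caveat (stated in the filing): at strong coupling the leaf's antecedent
(perimeter law in every limit state) is itself refuted by the Osterwalder–Seiler area law, so the leaf is vacuously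
known there; the rung separates the CURRENCIES (finite-volume flux traces vs. limit-state loop laws), not the regimes.
-/

section Rung
open Literature.MathematicalPhysics.QuantumFieldTheory Literature.MathematicalPhysics.QuantumLattice

/-- BC5 rung: the area-law branch of `GapForcesFluxAlternative` at `(N, r, z) = (2, fundamental, -𝟙)` for all
`|β| ≤ 1/(8·(8·3+1)²·e²)` and every plane `q` of the four-torus. -/
theorem gapForcesFluxAlternative_rung (β : ℝ)
    (hβ : |β| ≤ 1 / (8 * ((((8 * (4 - 1) : ℕ) : ℝ) + 1) ^ 2 * Real.exp 2)))
    (q : {p : Fin 4 × Fin 4 // p.1 < p.2}) :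
    ∃ σ C' : ℝ, 0 < σ ∧ ∀ (L : ℕ) [NeZero L], 2 ≤ L →
      1 - twistedPartitionFunction (fundamentalLatticeRep 2).ρ β L Tomboulis2007.negOne q /
            twistedPartitionFunction (fundamentalLatticeRep 2).ρ β L 1 q ≤
          C' * (L : ℝ) ^ 2 * Real.exp (-(σ * (L : ℝ) ^ 2)) := by
  obtain ⟨σ, hσ, C, h⟩ := Tomboulis2007.mainClaimTHooft_of_abs_le 4 hβ q
  refine ⟨σ, C, hσ, fun L _ hL => ?_⟩
  have h' := h L hL
  simpa [Tomboulis2007.su2WilsonVortexRatio, fundamentalLatticeRep] using h'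


end Rung

end Summit.QuantumFields.YangMills.Theorems.FluxSectorAlternative
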